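import Summits.CriticalPhenomena.PercolationContinuityZ3.Theorems.PercNearOneGluingNoHeavyLowerTailAntitheticCyclePlusBoundaryCount
import Summits.CriticalPhenomena.PercolationContinuityZ3.Theorems.PercNearOneGluingNoHeavyLowerTailAntitheticHarris
import HarnessLib

/-!
# `NoHeavyLowerTail` (stmt-CriticalPhenomena-4575) — antithetic cluster pairs: an unconditional instance of THEOREM C′'s reduction —
# `BIC_G({x}) ≥ 0` for `G` = cycle through `s` plus a degree-2 vertex `x` hung on two non-adjacent cycle vertices (prim-hp-2 gen 44)

Support file (`--supports stmt-CriticalPhenomena-4575`, hull-port prover `prim-hp-2`, gen 44).  No definitions, no named facts, no sorries; standard axioms.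

`Antithetic.cyclePlus_tsum_nonneg_of_chord` (…CyclePlusBoundaryCount) reduces `0 ≤ T_E(R, ∅)` for `E = E₀ + xy + xz` (`E₀` the cycle, `x ∈ R`) to the goodness of the
contracted cycle-plus-chord `E₀ + yz` for `(R, ∅)`.  When `R = {x}` the contracted constraint is vacuous (`x` meets no pair of `E₀ + yz`), so the contracted sum is the
plain antithetic Harris sum (`Antithetic.antithetic_harris`): hence
* `Antithetic.cyclePlus_bic_single_nonneg` — `0 ≤ T_E({x}, ∅; F, G) = BIC_G({x})` for all monotone `F, G`, where `G − x` is a cycle through `s`, `x ∉` the cycle has the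
  two non-adjacent cycle neighbours `y = v p`, `z = v q` (`0 < p, q < n`, `yz ∉ E₀`).  (`Antithetic.bic_single_nonneg` covered only neighbours of `s`; here `x` is at
  distance ≥ 2 from `s` in general — e.g. the far midpoint of `θ(ℓ₁, ℓ₂, 2)`.)
[cite: VandenbergHaggstromKahn2005, §1 p. 3 (open cluster `C_s`)]
-/

noncomputable section

namespace Summit.CriticalPhenomena.PercolationContinuityZ3.Theorems

open Literature.Probability.Percolation
open scoped Classical symmDiff

namespace Antithetic

variable {V : Type*} [Fintype V] {n : ℕ} {v : ℕ → V} (hn : 3 ≤ n) (hinj : ∀ i j, i < n → j < n → v i = v j → i = j) (hper : v n = v 0)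
include hn hinj hper

omit hn hinj hper in
/-- A vertex meeting no pair of `E` is never joined to `s ≠ x` by pairs of `E`, so the constraint set `tset_E({x}, ∅)` is everything. [this work] -/
theorem tset_singleton_eq_univ_of_isolated {E : Set (Sym2 V)} {s x : V} (hxs : x ≠ s) (hx : ∀ f ∈ E, x ∉ f) :
    Peel.tset E s {x} ∅ = Finset.univ := by
  refine Finset.eq_univ_iff_forall.2 fun ω => (Peel.mem_tset E s {x} ∅ ω).2 ⟨?_, fun y hy => absurd hy (Set.notMem_empty y)⟩
  intro r hr hboth
  rw [Set.mem_singleton_iff] at hr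
  subst hr
  exact Pendant.not_reachable_leaf (η := ω ∩ E) (ℓ := r) (fun f hf hrf => absurd hrf (hx f hf.2)) hxs.symm hboth.1

/-- **`BIC_G({x}) ≥ 0` for a degree-2 vertex `x` hung on a cycle through `s`.**  Cycle `v 0 = s, …, v (n−1)` (`n ≥ 3`), `x` off the cycle, `y = v p ≠ z = v q`
non-adjacent on the cycle (`0 < p, q < n`, `yz ∉ E₀`), `E = E₀ + xy + xz`: `0 ≤ T_E({x}, ∅; F, G)` for all monotone `F, G` — THEOREM C′ (`Antithetic.cyclePlus_change_nonneg`)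
plus DEG-2 ELIMINATION onto the cycle-plus-chord, where the constraint `{x}` is vacuous and antithetic Harris applies. [this work] -/
theorem cyclePlus_bic_single_nonneg {x : V} (hx : ∀ i, i < n → v i ≠ x) {p q : ℕ} (hp0 : 0 < p) (hpn : p < n) (hq0 : 0 < q) (hqn : q < n) (hpq : p ≠ q)
    (hchord : s(v p, v q) ∉ Cyc.edgeSet n v) {F G : Set (Sym2 V) → ℝ} (hF : Monotone F) (hG : Monotone G) :
    0 ≤ Peel.tsum F G (insert s(x, v p) (insert s(x, v q) (Cyc.edgeSet n v))) (v 0) {x} ∅ := by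
  have hn0 : 0 < n := by omega
  have hxs : x ≠ v 0 := fun h => hx 0 hn0 h.symm
  refine cyclePlus_tsum_nonneg_of_chord hn hinj hper hx hp0 hpn hq0 hqn hpq {x} (fun h => hxs (Set.mem_singleton_iff.1 h).symm)
    (Set.mem_singleton x) hchord (fun F' G' hF' hG' => ?_) hF hG
  have hiso : ∀ f ∈ insert s(v p, v q) (Cyc.edgeSet n v), x ∉ f := by
    rintro f (rfl | ⟨k, hk, rfl⟩) hxf
    · rcases Sym2.mem_iff.1 hxf with h | h
      · exact hx p hpn h.symm
      · exact hx q hqn h.symm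
    · exact CyclePlus.notMem_edgeSet_of_mem hper hx hn0 hxf ⟨k, hk, rfl⟩
  rw [Peel.tsum, tset_singleton_eq_univ_of_isolated hxs hiso]
  exact antithetic_harris _ _ hF' hG'

end Antithetic

end Summit.CriticalPhenomena.PercolationContinuityZ3.Theorems
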